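import Mathlib
import HarnessLib
import HarnessLib.Audit
import Summits.ResolutionOfSingularities.Statement
import Literature.AlgebraicGeometry.Resolution.ValuationDefect
import HarnessLib.Audit.Status.Attr

/-!
Route: DefectlessFrames

# Route DefectlessFrames — Zariski 1940 ported by Cutkosky-Mourtada; only defectless, pure Perron
frames are missing

TRANSFER route (lens transfer-with-dictionary, cycle 2; sibling = Zariski 1940, local uniformization
in ALL dimensions in characteristic 0, as re-run page by page in characteristic p by
Cutkosky–Mourtada 2019, plus the dimension-3 descendants Cutkosky 2009 / Cossart–Piltant;
DICTIONARY.md attached as evidence). It suffices to show X = DF ∧ PT ∧ E ∧ RR together with the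
perfect-field frame shared verbatim with InertialGeneration / ShadowGame / WildCones /
FrobeniusClosing / FoliationDescent (PatchingRelPerfect stmt-16161, DescentPerfectToAll stmt-0549).
DF = DefectlessFramesR (crux 2, the lever, algebraic half; rev 3 = the 1:1 repair of
DefectlessFrames stmt-19085, refuted-MISSTATED by Theorems.DefectlessFramesDefectlessFrames_refuted
— the frame hypothesis omitted `f ≠ 0`, so the degenerate frame n = 0, z transcendental, f = 0 met
it; C′ inserts `f ≠ 0 →` after the kernel hypothesis, making z algebraic over k(y) as intended, and
the witness corner n = 0 is then vacuous: K/k algebraic forces O = K, whose trivial valuation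
carries no RankOne): along a rank-one zero-dimensional valuation ring O over a PERFECT field, every
hypersurface frame k[y, z] inside O (y algebraically independent, z a primitive integral generator,
f its relation) is dominated by one whose projection K/k(y') is SEPARABLE and DEFECTLESS at O
([K·k(y')ʰ : k(y')ʰ] = e·f at the given place, typed since rev 1 by inlining the decomposition field
of V ∩ k(y')^sep (= the henselization) and e·f = n over ValuationDefect's valueSubgroup /
residueSubfield — definitionally the rev-0 IsDefectlessExtension/henselization form) with the axis
order mult f'(ȳ', X) not increased — Cutkosky–Mourtada's standing hypothesis "a defectless finite
linear projection can always be found", typed over all frames. PT = PureTranscendentalFrames (crux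
3, the lever, transcendental half — this dictionary's own finding): the same for frames of
algebraically independent elements carrying a polynomial, the last element being PURE over the
subfield of the others (attained distance, or Kaplansky transcendental approximation type). E =
ZariskiCMEngine (crux 6, the port): DF → PT → relative local uniformization at every rank-one
zero-dimensional valuation ring over perfect fields (target RankOneZeroDimUniformization) = Zariski
C.I–C.III with the characteristic-0 endgame (binomial step) replaced by Cutkosky–Mourtada Thm
6.1/7.1. RR = ResidueTranscendenceReduction (crux 4): rank-one zero-dimensional ⇒ all valuation
rings over perfect fields (its rank half is the tree's PROVED NovacoskiSpivakovsky2014_holds). No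
card realised (lens route).
Lean: `DefectlessFramesR ∧ PureTranscendentalFrames ∧ ZariskiCMEngine ∧
ResidueTranscendenceReduction ∧ PatchingRelPerfect ∧ DescentPerfectToAll`

## Assembly
Pure logic, certified sorry-free (Sketch.lean = glue.lean: lean check rc 0, 0 sorries): at a prime
p, ZariskiCMEngine applied to DefectlessFramesR and PureTranscendentalFrames is
RankOneZeroDimUniformization, whose body at p is the hypothesis of ResidueTranscendenceReduction p
hp; its conclusion is verbatim the antecedent of PatchingRelPerfect p hp, whose conclusion is
verbatim the antecedent of DescentPerfectToAll p hp, which returns ResolutionInChar p; the summit is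
∀ p prime, ResolutionInChar p by Iff.rfl: `closes (hDF : DefectlessFramesR) hPT hE hRR hP hD := fun
p hp => hD p hp (hP p hp (hRR p hp (hE hDF hPT p hp)))` (rev 3: the binder is the repaired lever;
ZariskiCMEngine and Assembly restated over it, since their rev-2 forms consumed the refuted
DefectlessFrames and had become provable ex falso) — every crux is a binder and occurs in the term;
no support is a binder. The route file needs Mathlib, the Statement and ONE definition-only
Literature module, ValuationDefect (valueSubgroup, residueSubfield, IsDefectlessIn; transitively
TranscendenceDefect: transcendenceDefect) — no unproved named fact enters the cone of any item, and
since rev 1 (cone repair) none lies even in the IMPORT closure of the route file: rev 0 imported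
HenselizedFunctionFields for two definitions, and its 50-module closure carried 13 unproved named
facts (Temkin2013*, CossartPiltant2019 LU3/Patching/LUComplete3, CossartJannsenSaito2020,
AbramovichOortConjecture) as dead weight that kept the route unstaffed. PatchingRelPerfect /
DescentPerfectToAll are byte-identical to InertialGeneration's decls, so dedup attaches this route
to stmt-16161 / stmt-0549.

Rationale: WHY THIS LINE. Zariski1940 proves local uniformization in every dimension in characteristic 0 by
Perron transforms and a double induction (number of variables, axis order s), and Cutkosky–Mourtada
(CutkoskyMourtada2019 = arXiv:1711.02726) re-ran it in characteristic p: everything transfers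
"through (A30)" and the ONLY non-transferring step is the endgame of the case s' = s, where the
binomial theorem (C(s,s−1) ≠ 0) puts the approximant of the last variable inside a FIXED Noetherian
ring (Zariski C.II §5, (67)–(69); CM p.10) — in characteristic p the approximants escape every fixed
ring and a bounded translation loop is exactly a pseudo-Cauchy sequence without limit, i.e. DEFECT
of the projection; CM Thm 7.1 proves that defect 0 of the finite linear projection restores the drop
of s (rank one, given the Lemma one dimension down). The dictionary adds the twin break CM gloss
over ("(1) is not so difficult … almost"): Zariski's Lemma case (an honest valuation on a polynomial
frame) loops forever exactly when the last variable is an unattained pseudo-limit of algebraic type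
over the subfield of the others. So the route posits precisely the two existence statements the
transferred proof consumes — defectless hypersurface frames (DF) and pure transcendental frames (PT)
— and files the port (E) and the residue-transcendence reduction Zariski did by an (in char p
inseparable) ground-field extension (RR). Imported area: valuation theory of function fields
(Kuhlmann2010 generalized stability, Kuhlmann2019 henselian rationality, KnafKuhlmann2005,
MacLane–Vaquié key polynomials, Kaplansky's approximation types), most of it ALREADY in the tree
(ValuationDefect, Henselization, HenselizedFunctionFields, GeneralizedStability*, Kuhlmann2019*,
RankOneReductionProofs). What no listed route does: use Zariski–Perron multiplicity reduction as the
LU engine — no degree-p climbing (CyclicCovers AsAscentRel, Valuative LuAlphaPTorsor,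
ShadowGame/WildCones/FrobeniusClosing torsor games), no étale generation (InertialGeneration's
InertiallyGenerated is the h-TRIVIAL strengthening e = f = 1, consumed by étale ascent +
RationalFieldUniformization), no multiplicity-below-p restriction (Cutkosky2009 Step 3 /
CossartPiltant2019 Thm 1.5: here s is arbitrary, defect 0 replaces degree < p).

RANKED CRUXES. #0 RankOneZeroDimUniformization (target) — relative Zariski local uniformization at
every RANK-ONE, ZERO-DIMENSIONAL valuation ring O ⊇ k of every finitely generated K/k, k PERFECT of
characteristic p: every f.g. R ⊆ O is dominated by a f.g. A ⊆ O with Frac A = K, regular at the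
centre. The output of the transferred engine (E applied to DF, PT). (why it might fail: it is local
uniformization itself at the essential valuations (CM §1: "the essential case"); open from trdeg 4;
fails only with the summit (tree lurel_of_resolutionInChar gives the converse direction).)
[CutkoskyMourtada2019, Zariski1940, NovacoskiSpivakovsky2014, Temkin2013]
#2 DefectlessFramesR (crux; rev 3: the repaired statement C′ of DefectlessFrames stmt-19085,
refuted-misstated for omitting `f ≠ 0`) — DEFECTLESS FRAMES (dictionary rows Z7/Z8/Z22): k perfect
of char p, K/k f.g., O a rank-one zero-dimensional valuation ring ⊇ k; every hypersurface frame (y :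
Fin n → O algebraically independent, z ∈ O, K = k(y,z), f a NONZERO generator of the relation ideal
— so z is algebraic over k(y) and trdeg K = n) is dominated (k[y,z] ⊆ k[y',z']) by a hypersurface
frame (y', z' integral over k[y'], f') in general position whose axis order rootMultiplicity_(z̄')
f'(ȳ',X) does not exceed that of (y,z,f), with K/k(y') separable and DEFECTLESS at O: for every
algebraic closure Ω ⊇ K and valuation ring V of Ω over O, IsDefectlessExtension V (k(y')ʰ)
(k(y')ʰ·K). [difficulty: open-problem] (why it might fail: frames are POLYNOMIAL (n+1 generators
containing the old ones): even where LU holds (trdeg 2–3) a regular model need not yield one, and at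
a non-Abhyankar place every projection of bounded axis order may carry dependent Artin–Schreier
defect (Kuhlmann2010 §1).) [CutkoskyMourtada2019, Zariski1940, Kuhlmann2010, Kuhlmann2019,
KnafKuhlmann2005, Temkin2013]
#3 PureTranscendentalFrames (crux) — PURE TRANSCENDENTAL FRAMES (row Z9, the Lemma case of Zariski's
loop): same valuation data; every frame of n+1 algebraically independent elements x of O with a
nonzero polynomial g is dominated (k[x] ⊆ k[x']) by such a frame x' with transported G (G(x') =
g(x)) in general position (G(x̄'₀..x̄'ₙ₋₁, X) ≠ 0), axis order not increased when x was in general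
position, whose last element w is PURE over K₁ = k(x'₀,…,x'ₙ₋₁): either some h ∈ K₁ attains the
distance (v(w − h) ≤ v(w − a) for all a ∈ K₁) or for every nonzero q ∈ K₁[X] some a ∈ K₁ has v(q(w)
− q(a)) < v(q(w)). [difficulty: open-problem] (why it might fail: a rank-one place of k(x₀..xₙ) can
make EVERY generator of bounded axis order an unattained pseudo-limit of algebraic type over the
others (immediate algebraic extensions of k(x')ʰ, Kuhlmann2010 defect), from trdeg 2 on — the typed
form of the kangaroo phenomenon.) [Zariski1940, CutkoskyMourtada2019, Kuhlmann2010,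
doi:10.1215/S0012-7094-42-00922-0, Kuhlmann2000]
#4 ResidueTranscendenceReduction (crux) — RESIDUE-TRANSCENDENCE REDUCTION (rows Z17/Z21): for every
prime p, relative local uniformization at all rank-one ZERO-DIMENSIONAL valuation rings over all
perfect fields of characteristic p and all f.g. K implies relative local uniformization at ALL
valuation rings over perfect fields (verbatim the antecedent of PatchingRelPerfect). The rank half
is Novacoski–Spivakovsky 2014 Thm 1.1 (tree, PROVED); the dimension half (rank one, residue field
transcendental over k, WITHOUT Zariski's ground-field extension Δ = k(ξ), which is imperfect in char
p) is the open content. [difficulty: L] (why it might fail: bad places with residue field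
k(t^(1/p^∞)) (Kuhlmann 2004) have no separating residue transcendence basis, so Zariski C.IV §9
lands in an inseparable zero-dim problem; no residue-transcendence reduction of LU is printed in
char p (NS2014 reduces rank; ZS VI §17 lowers dimension by RAISING rank).)
[NovacoskiSpivakovsky2014, Zariski1940, ZariskiSamuel1960, doi:10.1090/S0002-9947-04-03463-4,
CutkoskyMourtada2019]
#5 PatchingRelPerfect (crux) — Zariski patching over PERFECT ground fields (shared verbatim,
stmt-16161): for every prime p, relative local uniformization for all f.g. K/k with k perfect of
char p implies that every reduced separated scheme of finite type over every perfect field of char p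
has a resolution (row Z20 = the catalogued frontier's global half). [difficulty: open-problem] (why
it might fail: patching finitely many local uniformizations into a proper regular model is printed
only up to dimension 3 (Piltant2013; CossartPiltant2019 Prop 4.6); no fourth step is known
(DimensionFourFrontier), though the summit implies it.) [Piltant2013, CossartPiltant2019,
Cutkosky2009, Literature.Barriers.ResolutionOfSingularities.DimensionFourFrontier]
#6 ZariskiCMEngine (crux) — the PORT (rows Z1–Z6, Z10–Z16 glued; Z11 the only unknown inside;
restated rev 3 over the repaired lever): DefectlessFramesR → PureTranscendentalFrames →
RankOneZeroDimUniformization. Zariski 1940 A.IV (hypersurface frames), B (Perron transforms,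
char-free), C.I–C.III (simultaneous induction on the number of variables and on the axis order; the
translation loop) with the char-0 endgame replaced: in the Main-Theorem case by Cutkosky–Mourtada
Thm 6.1 (attained distance ∉ Φ ⇒ s drops, PROVED char-free) and Thm 7.1 (defect 0 ⇒ attained, rank
one); in the Lemma case by Kaplansky's transcendental-type approximation (tree
ImmediateRationalUniformization); residue extensions f > 1 (CM assume residue field = k) by finite
MacLane key-polynomial chains (defect 0 ⇔ no limit key polynomials, CM §5). [deps:
DefectlessFramesR, PureTranscendentalFrames] [difficulty: XL] (why it might fail: CM Thm 7.1 is
printed for RESIDUE FIELD = k only; with f(ν*/ν) > 1 the attained distance may lie in Φ_ν and the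
move is a degree-[κ(c):κ] key-polynomial substitution whose axis-order bookkeeping (Zariski's c =
−d_(s−1)/s is unavailable when p ∣ s) is unwritten.) [Zariski1940, CutkoskyMourtada2019,
doi:10.1090/S0002-9947-07-04184-0, Kuhlmann2019, KnafKuhlmann2005]
#7 DescentPerfectToAll (crux) — perfect fields ⇒ all fields of characteristic p (shared verbatim,
stmt-0549; row Z19: Zariski's "arbitrary ground field" device B.4/C.IV §9 is a ground-field
extension, inseparable in char p). [difficulty: open-problem] (why it might fail: regularity and
HasResolution are not stable under inseparable ground-field extension
(InseparableBaseChangeResolution, RegularNotGeometricallyRegular); the descent needs spreading out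
over a f.g. imperfect k plus openness of Reg, possibly open as stated.) [CossartPiltant2019,
Temkin2013, Kollar2007, Literature.Barriers.ResolutionOfSingularities.InseparableBaseChange]
#9 TargetOfResolution (support) — the target is a CONSEQUENCE of the summit (tree
lurel_of_resolutionInChar specialised to rank-one zero-dimensional valuation rings over perfect
fields) — the route is two-sided; provable now. [difficulty: provable-now] [CutkoskyMourtada2019,
Temkin2013]
#9 AbhyankarProjectionsDefectless (support) — the defectless half of the lever at ABHYANKAR
projections (BC5-type special case, provable from tree facts): if y : Fin n → O is algebraically
independent with K algebraic over k(y) and O ∩ k(y) has transcendence defect 0 over k, then K/k(y)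
is defectless at every extension of O ∩ k(y) (IsDefectlessIn): Kuhlmann2010Stability_holds (PROVED
in tree) makes (k(y), O ∩ k(y)) a defectless field. [difficulty: provable-now] [Kuhlmann2010,
KnafKuhlmann2005, Temkin2013]

TWO-LAYER PLAN. Foreseen glued splits (the BC3 birth skeletons in the planner folder,
bc/*_birth.lean, each lean check rc 0 with sorries = stubs = 2): DefectlessFramesR ⇐ stub_abhyankar
(transcendence defect 0: generalized stability) → stub_transcendenceDefect (defect > 0: henselian
rationality) → DefectlessFramesR (by cases); PureTranscendentalFrames ⇐ the same dichotomy;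
ZariskiCMEngine ⇐ stub_lemma (DF → PT → ZariskiLemma = monomialisation (59) in every dimension) →
stub_main (ZariskiLemma → DF → target) → ZariskiCMEngine; ResidueTranscendenceReduction ⇐
stub_dimension (zero-dim rank-one ⇒ rank-one, the open half) → stub_rank (rank-one ⇒ all:
NovacoskiSpivakovsky2014_holds + adjoining field generators, provable) → RR. Nothing is filed now.

KILL CRITERIA. Refuting DefectlessFramesR or PureTranscendentalFrames at a GENUINE frame (f ≠ 0, n ≥
1) on an explicit valued function field of trdeg 2 or 3 (where LU holds) closes the route outright
(close --reason refuted:<Decl>; the rev-2 refutation of DefectlessFrames by the degenerate frame n =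
0, f = 0 was a misstatement, repaired in rev 3, not a kill): it shows Zariski's polynomial-frame
architecture cannot be rescued by re-projection and hands the typed witness to lens
barrier-inversion (a new catalogued barrier "defect is not removable by re-framing"). Refuting
ResidueTranscendenceReduction forces a pivot of the frame to AbhyankarShadows' rational/k̄ frame
(LurelRational + RationalSuffices + PatchingPerfect + DescentAlgclosedToPerfect) with the engine
restated for rational valuation rings (CM Thm 7.1 literally). A proof of InertialGeneration's
InertiallyGenerated (stmt-17003) moots DefectlessFramesR's algebraic half (h-trivial ⇒ defectless)
but not PT, E or RR; a proof of any other route's LU crux set (Valuative, CyclicCovers, IndSmooth,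
AbhyankarShadows) supersedes the engine.

NOT DECOMPOSED YET. The port E is deliberately ONE item: its natural pieces (Perron transforms Thm
1–4, CM Thm 6.1 algebra, CM Thm 7.1 valuation theory, Kaplansky step, the double induction, A.IV
domination bookkeeping) are transfers-proved rows of the dictionary and become `--supports
ZariskiCMEngine` lemmas of its prover, not items (D-0019 two layers). The f > 1 key-polynomial
bookkeeping (row Z11) is the one place inside E a prover may ask to split out. Rank reduction inside
RR is not split from the dimension half at open (the skeleton shows the seam). No finite-field
special handling: general position is part of the frame cruxes' conclusions (Nagata-type non-linear
re-framings are allowed), not a separate item.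

CHEAPEST FALSIFIER. DefectlessFramesR at ONE explicit non-Abhyankar rank-one place of a SURFACE:
take Kuhlmann's valuation on k(x,y) admitting an immediate Artin–Schreier defect extension K =
k(x,y)(ϑ), ϑ^p − ϑ = a(x,y) (Kuhlmann2010 §1 / his classification of AS-defect extensions), the
frame (y; z) = ((x,y); ϑ), and decide with MacLane–Vaquié key polynomials whether the re-framings
(x, ϑ; y), (y, ϑ; x) and (x + λϑ, y + μϑ; ·) are defectless at the chosen extension — a finite
symbolic computation per frame (kit pari/sage or by hand); if every frame of axis order ≤ p has
defect, DF is refuted in trdeg 2 where LU holds, and the route closes with a new barrier. Not run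
this session (no CAS with key-polynomial support wired; recorded for the refuter). Lookup falsifier
run: ledger negatives (0 refuted statements), lean search / BC4 exact? against all 32 route files
and the Resolution literature (no existing decl proves or restates any crux).

NUMBERS. Dimension: LU and resolution known for trdeg ≤ 3 in all characteristics (CossartPiltant2019
Thm 1.1), open from 4 (DimensionFourFrontier: LU₄ ∧ ZariskiPatchingUpToDim 4). Characteristic:
Cutkosky2009 Thm 8.4 needs p > 5 = beyond 3! because its projection has degree e(S) ≤ 3! < p, which
forces defect 0 ((36): e(S₀) ≤ [L₀*:K₀*] ≤ [L*:K*] = e(S) < p); DF removes the degree bound and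
keeps only defect 0. Axis order s: arbitrary (Zariski/CM), versus multiplicity ≤ p in
CossartPiltant2019 Thm 1.5. Defect: [Kʰ·K*:Kʰ] = e·f·p^δ (Ostrowski; CM (Ost)); the lever asks δ = 0
for ONE extension, not IsDefectlessIn for all.

DEFINITION REQUESTS. None blocking: henselization, IsDefectlessExtension, IsDefectlessIn,
transcendenceDefect, IsImmediateOver exist in Literature/AlgebraicGeometry/Resolution (definitions
only are used). Wanted later (not filed now): MacLane–Vaquié key polynomials / admissible families
(CM §5; doi:10.1090/S0002-9947-07-04184-0) as a Literature topic for the prover of ZariskiCMEngine;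
Perron transforms (Zariski1940 B.I Thm 1–2 = CM Lemma 4.1) as a small char-free Literature file.

DEGENERATE CASES CHECKED. (rev 3 repair pass over C′ = DefectlessFramesR.) f = 0 is now excluded by
hypothesis (the rev-2 witness k = 𝔽₂, K = k(X), O the X-adic ring, n = 0, z = X, f = 0). n = 0 with
f ≠ 0: z is algebraic over k, K = k(z) is algebraic over k, so O = K (tree
ValuationSubring.eq_top_of_forall_algebraMap_mem) and O.valuation is trivial, which admits no
RankOne (Mathlib Valuation.RankOne extends IsNontrivial) — the corner is vacuous, so the whole
witness family misses C′. General position axis(y′, f′) ≠ 0 is automatic once z′ is integral over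
k[y′] (f′ = unit · the monic minimal polynomial of z′ over k[y′]), and s′ ≥ 1 always (f′(y′, z′) = 0
residually), so the axis clause is never discharged vacuously. s = 1 frames in general position are
ALREADY separable and defectless at O (Hensel in the henselization: κ(O ∩ k(y)) is perfect, so the
residual factor through z̄ is separable and simple, forcing e = 1, p^δ = 1) — the content of the
crux is s ≥ 2, as intended. n = 1 (curves): every place is Abhyankar, defect 0 is automatic, and a
Zariski A.IV / Nagata re-framing y′ = y − c·z^(p^e) inside k[y, z] gives integrality with s′ ≤ s —
expected provable, informative only from trdeg 2 on (CHEAPEST FALSIFIER). PureTranscendentalFrames,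
ResidueTranscendenceReduction (trivial-O case: A = R with field generators adjoined, localisation at
⊥ is the field K), the target and the supports were re-read in the same pass (refuter route review
2026-08-17: no smell); PatchingRelPerfect / DescentPerfectToAll are the shared stamped frame.

Novelty: Searches (2026-08-17): ledger negatives --problem ResolutionOfSingularities (0); lean search / grep
of all 32 Theses for CutkoskyMourtada2019 (cited by 10 routes, always for "ELU unknown in dim 4" or
"defect is the only obstruction", never as an engine), for "defectless|Perron|key
polynomial|MacLane|Vaquie" (Perron only inside CyclicCovers' sources; MacLane only in closed cards);
Ideas/ grep "Mourtada" (23 cards: kangaroo-valuations-are-pseudo-cauchy and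
follow-valuation-break-stabilisation use CM for the degree-p torsor cruxes 0641/0566, none
re-projects); lit search (payload sibling_sources, 2 queries × 12 hits: Kollár 2007, CJS 2020,
Cutkosky 2009 held); lit galaxy search "Local uniformization on algebraic varieties" --star all (17
rows; Zariski Collected Papers I located and READ at page level, panama:220074124247075); primary
reads: Zariski1940 pp. 852–896, CutkoskyMourtada2019 all 13 pp., Cutkosky2009 Thm 8.4 pp. 31–33,
CossartPiltant2019 §1 pp. 2–5; barrier DimensionFourFrontier (lists CM Thm 7.1 as evasion (iv),
unused by any route).
Nearest prior art found: CutkoskyMourtada2019 (arXiv:1711.02726) Thm 7.1 — the conditional engine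
itself, for residue field = k, rank one, with the defectless hypothesis left as "if a suitable
linear projection can always be found"; route InertialGeneration (stmt-17003 InertiallyGenerated =
Kuhlmann's h-trivial generation, the étale strengthening, with RationalFieldUniformization assumed
in all dimensions); Zariski1940 (the char-0 sibling  [refs: 1711.02726, CutkoskyMourtada2019, Zariski1940, Cutkosky2009, CossartPiltant2019]

Barriers (technique_class: transfer, zariski-perron-lu, defectless-frames): - technique_class: transfer, zariski-perron-lu, defectless-frames,
local-uniformization-plus-patching
- Literature.Barriers.ResolutionOfSingularities.DimensionFourFrontier: APPLIES as state of knowledge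
(the route is Zariski's programme: LU then patching; LU₄ is a necessary waypoint of every proof) and
is met where it is a frontier, not an impossibility: its "because" clause (CM: the dimension step
breaks at the binomial theorem; "what survives is LRM under a defectless finite projection, Thm
7.1", evasion (iv)) is exactly the lever; the embedded input ELU is not assumed in dimension 4 but
produced by Zariski's own Lemma induction from DF ∧ PT; the global half (patching) is inherited
unchanged as the shared crux PatchingRelPerfect — not evaded, the bet is on the local half.
- Literature.Barriers.ResolutionOfSingularities.Hauser2003_kangarooShadeIncrease: evaded by
construction — no residual order / shade is used (nor Moh's bound, hauserPerlega_mohProofBoundFails;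
nor a hypersurface of maximal contact, Narasimhan's example); the only measure is Zariski's axis
order s with value-monotone translations, and the divergent-run phenomenon is quarantined INTO the
hypotheses (an unattained pseudo-limit = failure of purity/defectlessness of the current frame),
which DF/PT assert can be re-framed away; if Hauser–Perlega-type runs defeat every re-framing, DF/PT
are refuted, informatively.
- Literature.Barriers.ResolutionOfSingularities.KangarooShadeIncreaseNarrow: same — the narrowed sta

History (route lifecycle, newest last):
- 2026-08-17T03:49:31Z · rev 1: restated DefectlessFrames (stmt-ResolutionOfSingularities-18873) — cone repair (route-repair rrepair-…-bd016126): imports [HenselizedFunctionFields, TranscendenceDefect] → [ValuationDefect]; DefectlessFrames restated 1:1 by inl (planner-rrepair-ResolutionOfSingularities-Defe-bd016126-0)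
- 2026-08-17T04:47:21Z · BROKEN — DefectlessFrames (stmt-ResolutionOfSingularities-19085, crux) refuted by Summit.ResolutionOfSingularities.ResolutionOfSingularities.Theorems.DefectlessFramesDefectlessFrames_refuted @ f246b518946f (refuter-rreview-0817T03-1-0)
- 2026-08-17T05:08:53Z · rev 3: restated DefectlessFrames (stmt-ResolutionOfSingularities-19085 refuted), ZariskiCMEngine (stmt-ResolutionOfSingularities-18876), Assembly (stmt-ResolutionOfSingularities-18879) — repair (route-repair rfix-ResolutionOfSingularities-Defec-bd016126, rev 3): DefectlessFrames (stmt-19085, crux r2) was refuted-MISSTA (planner-rfix-ResolutionOfSingularities-Defec-bd016126-0)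
- 2026-08-17T05:08:53Z · REPAIRED (restate DefectlessFrames, ZariskiCMEngine, Assembly) — back to open: repair (route-repair rfix-ResolutionOfSingularities-Defec-bd016126, rev 3): DefectlessFrames (stmt-19085, crux r2) was refuted-MISSTATED by Theorems.DefectlessF (planner-rfix-ResolutionOfSingularities-Defec-bd016126-0)
- 2026-08-25T10:53:01Z · DORMANT — reconciler: no traction for 7.6 d (last activity item-evidence-added at 2026-08-17T19:12:28Z); parked, not closed — `ledger route dormant route-ResolutionOfSing (operator:999:1868975)
- 2026-08-26T17:00:50Z · REACTIVATED — reconciler: reactivated — activity statement-claimed at 2026-08-26T16:25:04Z after parking at 2026-08-25T10:53:01Z (operator:999:3503023)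

sub-problem: ResolutionOfSingularities · status: open · opened planner-plan-lens3-ResolutionOfSingularities-transfer-g2-0 2026-08-17T03:05:15Z · rev 3 · ledger route-ResolutionOfSingularities-DefectlessFrames
GENERATED by the gate from the ledger (D-0016/17). Provers cite these decls: `theorem foo : Summit.ResolutionOfSingularities.ResolutionOfSingularities.Theses.DefectlessFrames.<Decl> := …` in Summits/ResolutionOfSingularities/ResolutionOfSingularities/Theorems/<Name>.lean.
-/

namespace Summit.ResolutionOfSingularities.ResolutionOfSingularities.Theses.DefectlessFrames

open scoped BigOperators Topology Manifold Classical MeasureTheory ProbabilityTheory Matrix InnerProductSpace ComplexConjugate ContinuousMap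
open Filter Set Function TopologicalSpace MeasureTheory

attribute [summit_statement] _root_.ResolutionOfSingularities

/-- item stmt-ResolutionOfSingularities-18872 · target · rank 0 · open · by planner
why it might fail: it is local uniformization itself at the essential valuations (CM §1: "the essential case"); open from trdeg 4; fails only with the summit (tree lurel_of_resolutionInChar gives the converse direction).
sources: CutkoskyMourtada2019, Zariski1940, NovacoskiSpivakovsky2014, Temkin2013
[target] relative Zariski local uniformization at every RANK-ONE, ZERO-DIMENSIONAL valuation ring O
⊇ k of every finitely generated K/k, k PERFECT of characteristic p: every f.g. R ⊆ O is dominated by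
a f.g. A ⊆ O with Frac A = K, regular at the centre. The output of the transferred engine (E applied
to DF, PT). -/
@[route_item "route-ResolutionOfSingularities-DefectlessFrames"]
def RankOneZeroDimUniformization : Prop :=
  ∀ p : ℕ, p.Prime → ∀ (k K : Type) [Field k] [CharP k p] [PerfectField k] [Field K] [Algebra k K], (⊤ : IntermediateField k K).FG → ∀ O : ValuationSubring K, (∀ c : k, algebraMap k K c ∈ O) → Nonempty O.valuation.RankOne → (∀ x ∈ O, ∃ f : Polynomial k, f ≠ 0 ∧ Polynomial.aeval x f ∈ O.nonunits) → ∀ R : Subalgebra k K, R.FG → R.toSubring ≤ O.toSubring → ∃ (A : Subalgebra k K) (h : A.toSubring ≤ O.toSubring), R ≤ A ∧ A.FG ∧ IsFractionRing A K ∧ IsRegularLocalRing (Localization.AtPrime (Ideal.comap (Subring.inclusion h) (IsLocalRing.maximalIdeal O)))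

/-- item stmt-ResolutionOfSingularities-17921 · crux · rank 2 · open · by planner
why it might fail: frames are POLYNOMIAL (n+1 generators containing the old ones): even where LU holds (trdeg 2–3) a regular model need not yield one, and at a non-Abhyankar place every dominating frame of axis order ≤ s (s ≥ 2) may carry dependent Artin–Schreier defect (Kuhlmann2010 §1).
sources: CutkoskyMourtada2019, arXiv:1711.02726, Zariski1940, Kuhlmann2010, Kuhlmann2019, KnafKuhlmann2005
[crux] DEFECTLESS FRAMES, REPAIRED (rev 3: 1:1 replacement of DefectlessFrames
stmt-ResolutionOfSingularities-19085, refuted-misstated by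
Theorems.DefectlessFramesDefectlessFrames_refuted @ f246b518946f — the frame hypothesis omitted `f ≠
0`, so the degenerate frame n = 0, z transcendental, f = 0 met it while the conclusion forced K/k
algebraic; C′ inserts `f ≠ 0 →` after the kernel hypothesis, so z is algebraic over k(y) and trdeg K
= n; the witness corner n = 0 is then vacuous: K/k algebraic forces O = K (tree
ValuationSubring.eq_top_of_forall_algebraMap_mem), whose trivial valuation admits no RankOne).
Dictionary rows Z7/Z8/Z22: k perfect of char p, K/k f.g., O a rank-one zero-dimensional valuation
ring ⊇ k; every hypersurface frame (y : Fin n → O algebraically independent, z ∈ O, K = k(y,z), f a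
NONZERO generator of the relation ideal) is dominated (k[y,z] ⊆ k[y',z']) by a hypersurface frame
(y', z' integral over k[y'], f') in general position whose axis order rootMultiplicity_(z̄')
f'(ȳ',X) does not exceed that of (y,z,f), with K/k(y') separable and DEFECTLESS at O
(Cutkosky–Mourtada Thm 7.1: δ(ν*/ν) = 0): for every algebraic closure Ω ⊇ K and valuation ring V of
Ω over O, wit -/
@[route_item "route-ResolutionOfSingularities-DefectlessFrames", crux]
def DefectlessFramesR : Prop :=
  ∀ p : ℕ, p.Prime → ∀ (k K : Type) [Field k] [CharP k p] [PerfectField k] [Field K] [Algebra k K], (⊤ : IntermediateField k K).FG → ∀ O : ValuationSubring K, ∀ hk : (∀ c : k, algebraMap k K c ∈ O), Nonempty O.valuation.RankOne → (∀ x ∈ O, ∃ f : Polynomial k, f ≠ 0 ∧ Polynomial.aeval x f ∈ O.nonunits) → let ρ : k →+* IsLocalRing.ResidueField O := (IsLocalRing.residue O).comp ((algebraMap k K).codRestrict O hk); let axis : (m : ℕ) → (Fin m → O) → MvPolynomial (Fin (m + 1)) k → Polynomial (IsLocalRing.ResidueField O) := fun _ w g => MvPolynomial.eval₂ (Polynomial.C.comp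 ρ) (Fin.snoc (fun j => Polynomial.C (IsLocalRing.residue O (w j))) Polynomial.X) g; ∀ (n : ℕ) (y : Fin n → O) (z : O) (f : MvPolynomial (Fin (n + 1)) k), AlgebraicIndependent k (fun i => (y i : K)) → IntermediateField.adjoin k (Set.range (fun i => (y i : K)) ∪ {(z : K)}) = ⊤ → Ideal.span {f} = RingHom.ker (MvPolynomial.aeval (Fin.snoc (fun i => (y i : K)) (z : K)) : MvPolynomial (Fin (n + 1)) k →ₐ[k] K) → f ≠ 0 → ∃ (y' : Fin n → O) (z' : O) (f' : MvPolynomial (Fin (n + 1)) k), AlgebraicIndependent k (fun i => (y' i : K)) ∧ IsIntegral (Algebra.adjoin k (Set.range fun i => (y' i : K))) (z' : K) ∧ IntermediateField.adjoin k (Set.range (fun i => (y' i : K)) ∪ {(z' : K)}) = ⊤ ∧ Ideal.span {f'} = RingHom.ker (MvPolynomial.aeval (Fin.snoc (fun i => (y' i : K)) (z' : K)) : MvPolynomial (Fin (n + 1)) k →ₐ[k] K) ∧ (∀ i, (y i : K) ∈ Algebra.adjoin k (Set.range (fun i => (y' i : K)) ∪ {(z' : K)})) ∧ (z : K) ∈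 Algebra.adjoin k (Set.range (fun i => (y' i : K)) ∪ {(z' : K)}) ∧ axis n y' f' ≠ 0 ∧ (axis n y f ≠ 0 → (axis n y' f').rootMultiplicity (IsLocalRing.residue O z') ≤ (axis n y f).rootMultiplicity (IsLocalRing.residue O z)) ∧ IsSeparable (IntermediateField.adjoin k (Set.range fun i => (y' i : K))) (z' : K) ∧ ∀ (Ω : Type) [Field Ω] [Algebra K Ω] [IsAlgClosure K Ω] (V : ValuationSubring Ω), V.comap (algebraMap K Ω) = O → let F : Subfield Ω := (IntermediateField.adjoin k (Set.range fun i => (y' i : K))).toSubfield.map (algebraMap K Ω); let Fh : Subfield Ω := (IntermediateField.lift (IntermediateField.fixedField (ValuationSubring.decompositionSubgroup F (V.comap (algebraMap (separableClosure F Ω) Ω))))).toSubfield; let T : Subfield Ω := Fh ⊔ (algebraMap K Ω).fieldRange; Fh ≤ T ∧ 0 < Subfield.relfinrank Fh T ∧ Subfield.relfinrank Fh T = (Literature.AlgebraicGeometry.Resolution.valueSubgroup Fh V).relIndex (Literature.AlgebraicGeometry.Resolution.valueSubgroup T V) * (Literature.AlgebraicGeometry.Resolution.residueSubfield Fh V).relfinrank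 (Literature.AlgebraicGeometry.Resolution.residueSubfield T V)

/-- item stmt-ResolutionOfSingularities-18874 · crux · rank 3 · open · by planner
why it might fail: a rank-one place of k(x₀..xₙ) can make EVERY generator of bounded axis order an unattained pseudo-limit of algebraic type over the others (immediate algebraic extensions of k(x')ʰ, Kuhlmann2010 defect), from trdeg 2 on — the typed form of the kangaroo phenomenon.
sources: Zariski1940, CutkoskyMourtada2019, Kuhlmann2010, doi:10.1215/S0012-7094-42-00922-0, Kuhlmann2000
[crux] PURE TRANSCENDENTAL FRAMES (row Z9, the Lemma case of Zariski's loop): same valuation data;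
every frame of n+1 algebraically independent elements x of O with a nonzero polynomial g is
dominated (k[x] ⊆ k[x']) by such a frame x' with transported G (G(x') = g(x)) in general position
(G(x̄'₀..x̄'ₙ₋₁, X) ≠ 0), axis order not increased when x was in general position, whose last
element w is PURE over K₁ = k(x'₀,…,x'ₙ₋₁): either some h ∈ K₁ attains the distance (v(w − h) ≤ v(w
− a) for all a ∈ K₁) or for every nonzero q ∈ K₁[X] some a ∈ K₁ has v(q(w) − q(a)) < v(q(w)).
[difficulty: open-problem] -/
@[route_item "route-ResolutionOfSingularities-DefectlessFrames", crux]
def PureTranscendentalFrames : Prop :=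
  ∀ p : ℕ, p.Prime → ∀ (k K : Type) [Field k] [CharP k p] [PerfectField k] [Field K] [Algebra k K], (⊤ : IntermediateField k K).FG → ∀ O : ValuationSubring K, ∀ hk : (∀ c : k, algebraMap k K c ∈ O), Nonempty O.valuation.RankOne → (∀ x ∈ O, ∃ f : Polynomial k, f ≠ 0 ∧ Polynomial.aeval x f ∈ O.nonunits) → let ρ : k →+* IsLocalRing.ResidueField O := (IsLocalRing.residue O).comp ((algebraMap k K).codRestrict O hk); let axis : (m : ℕ) → (Fin (m + 1) → O) → MvPolynomial (Fin (m + 1)) k → Polynomial (IsLocalRing.ResidueField O) := fun _ w g => MvPolynomial.eval₂ (Polynomial.C.comp ρ) (Fin.snoc (fun j => Polynomial.C (IsLocalRing.residue O (w (Fin.castSucc j)))) Polynomial.X) g; ∀ (n : ℕ) (x : Fin (n + 1) → O) (g : MvPolynomial (Fin (n + 1)) k), AlgebraicIndependent k (fun i => (x i : K)) → g ≠ 0 → ∃ (x' : Fin (n + 1) → O) (G : MvPolynomial (Fin (n + 1)) k), AlgebraicIndependent k (fun i => (x' i : K)) ∧ (∀ i, (x i : K) ∈ Algebra.adjoin k (Set.range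 fun i => (x' i : K))) ∧ MvPolynomial.aeval (fun i => (x' i : K)) G = MvPolynomial.aeval (fun i => (x i : K)) g ∧ axis n x' G ≠ 0 ∧ (axis n x g ≠ 0 → (axis n x' G).rootMultiplicity (IsLocalRing.residue O (x' (Fin.last n))) ≤ (axis n x g).rootMultiplicity (IsLocalRing.residue O (x (Fin.last n)))) ∧ let K₁ : IntermediateField k K := IntermediateField.adjoin k (Set.range fun j : Fin n => (x' (Fin.castSucc j) : K)); let w : K := (x' (Fin.last n) : K); ((∃ h ∈ K₁, ∀ a ∈ K₁, O.valuation (w - h) ≤ O.valuation (w - a)) ∨ (∀ q : Polynomial K₁, q ≠ 0 → ∃ a : K₁, O.valuation (Polynomial.aeval w q - algebraMap K₁ K (Polynomial.eval a q)) < O.valuation (Polynomial.aeval w q)))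

/-- item stmt-ResolutionOfSingularities-18875 · crux · rank 4 · open · by planner
why it might fail: bad places with residue field k(t^(1/p^∞)) (Kuhlmann 2004) have no separating residue transcendence basis, so Zariski C.IV §9 lands in an inseparable zero-dim problem; no residue-transcendence reduction of LU is printed in char p (NS2014 reduces rank; ZS VI §17 lowers dimension by RAISING rank).
sources: NovacoskiSpivakovsky2014, Zariski1940, ZariskiSamuel1960, doi:10.1090/S0002-9947-04-03463-4, CutkoskyMourtada2019
[crux] RESIDUE-TRANSCENDENCE REDUCTION (rows Z17/Z21): for every prime p, relative local
uniformization at all rank-one ZERO-DIMENSIONAL valuation rings over all perfect fields of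
characteristic p and all f.g. K implies relative local uniformization at ALL valuation rings over
perfect fields (verbatim the antecedent of PatchingRelPerfect). The rank half is
Novacoski–Spivakovsky 2014 Thm 1.1 (tree, PROVED); the dimension half (rank one, residue field
transcendental over k, WITHOUT Zariski's ground-field extension Δ = k(ξ), which is imperfect in char
p) is the open content. [difficulty: L] -/
@[route_item "route-ResolutionOfSingularities-DefectlessFrames", crux]
def ResidueTranscendenceReduction : Prop :=
  ∀ p : ℕ, p.Prime → (∀ (k K : Type) [Field k] [CharP k p] [PerfectField k] [Field K] [Algebra k K], (⊤ : IntermediateField k K).FG → ∀ O : ValuationSubring K, (∀ c : k, algebraMap k K c ∈ O) → Nonempty O.valuation.RankOne → (∀ x ∈ O, ∃ f : Polynomial k, f ≠ 0 ∧ Polynomial.aeval x f ∈ O.nonunits) → ∀ R : Subalgebra k K, R.FG → R.toSubring ≤ O.toSubring → ∃ (A : Subalgebra k K) (h : A.toSubring ≤ O.toSubring), R ≤ A ∧ A.FG ∧ IsFractionRing A K ∧ IsRegularLocalRing (Localization.AtPrime (Ideal.comap (Subring.inclusion h) (IsLocalRing.maximalIdeal O)))) → ∀ (k K : Type) [Field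 k] [CharP k p] [PerfectField k] [Field K] [Algebra k K], (⊤ : IntermediateField k K).FG → ∀ O : ValuationSubring K, (∀ c : k, algebraMap k K c ∈ O) → ∀ R : Subalgebra k K, R.FG → R.toSubring ≤ O.toSubring → ∃ (A : Subalgebra k K) (h : A.toSubring ≤ O.toSubring), R ≤ A ∧ A.FG ∧ IsFractionRing A K ∧ IsRegularLocalRing (Localization.AtPrime (Ideal.comap (Subring.inclusion h) (IsLocalRing.maximalIdeal O)))

/-- item stmt-ResolutionOfSingularities-16161 · crux · rank 5 · open · by planner
why it might fail: patching finitely many local uniformizations into a proper regular model is printed only up to dimension 3 (Piltant2013; CossartPiltant2019 Prop 4.6); no fourth step is known (DimensionFourFrontier), though the summit implies it.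
sources: Piltant2013, CossartPiltant2019, Cutkosky2009, Literature.Barriers.ResolutionOfSingularities.DimensionFourFrontier
[crux] Zariski patching over PERFECT ground fields: for every prime p, relative local uniformization
(every f.g. R ⊆ O is dominated by a f.g. A ⊆ O with Frac A = K, regular at the centre) for all f.g.
K/k with k perfect of char p implies that every reduced separated scheme of finite type over every
perfect field of char p has a resolution. Fibrewise identical to Valuative's PatchingRel (stmt-0642)
restricted to perfect k — one patching argument proves both. [difficulty: open-problem] -/
@[route_item "route-ResolutionOfSingularities-DefectlessFrames", crux]
def PatchingRelPerfect : Prop :=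
  ∀ p : ℕ, p.Prime → (∀ (k K : Type) [Field k] [CharP k p] [PerfectField k] [Field K] [Algebra k K], (⊤ : IntermediateField k K).FG → ∀ O : ValuationSubring K, (∀ c : k, algebraMap k K c ∈ O) → ∀ R : Subalgebra k K, R.FG → R.toSubring ≤ O.toSubring → ∃ (A : Subalgebra k K) (h : A.toSubring ≤ O.toSubring), R ≤ A ∧ A.FG ∧ IsFractionRing A K ∧ IsRegularLocalRing (Localization.AtPrime (Ideal.comap (Subring.inclusion h) (IsLocalRing.maximalIdeal O)))) → ∀ (k : Type) [Field k] [CharP k p] [PerfectField k] (X : AlgebraicGeometry.Scheme.{0}) (f : X ⟶ AlgebraicGeometry.Spec (.of k)), AlgebraicGeometry.IsSeparated f → AlgebraicGeometry.LocallyOfFiniteType f → AlgebraicGeometry.QuasiCompact f → AlgebraicGeometry.IsReduced X → Literature.AlgebraicGeometry.Resolution.Scheme.HasResolution X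

-- earlier ZariskiCMEngine (stmt-ResolutionOfSingularities-18876, replaced 2026-08-17T05:08:53Z -> stmt-ResolutionOfSingularities-17922): retired by None — DefectlessFrames → PureTranscendentalFrames → RankOneZeroDimUniformization
/-- item stmt-ResolutionOfSingularities-17922 · crux · rank 6 · open · by planner
why it might fail: CM Thm 7.1 is printed for RESIDUE FIELD = k only; with f(ν*/ν) > 1 the attained distance may lie in Φ_ν and the move is a degree-[κ(c):κ] key-polynomial substitution whose axis-order bookkeeping (Zariski's c = −d_(s−1)/s is unavailable when p ∣ s) is unwritten.
sources: Zariski1940, CutkoskyMourtada2019, doi:10.1090/S0002-9947-07-04184-0, Kuhlmann2019, KnafKuhlmann2005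
[crux] the PORT (rows Z1–Z6, Z10–Z16 glued; Z11 the only unknown inside), RESTATED rev 3 over the
repaired lever: DefectlessFramesR → PureTranscendentalFrames → RankOneZeroDimUniformization (the
rev-0/2 form consumed the refuted DefectlessFrames stmt-19085 and had become provable ex falso; same
port, same name, new item). Zariski 1940 A.IV (hypersurface frames), B (Perron transforms,
char-free), C.I–C.III (simultaneous induction on the number of variables and on the axis order; the
translation loop) with the char-0 endgame replaced: in the Main-Theorem case by Cutkosky–Mourtada
Thm 6.1 (attained distance ∉ Φ ⇒ s drops, PROVED char-free) and Thm 7.1 (defect 0 ⇒ attained, rank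
one); in the Lemma case by Kaplansky's transcendental-type approximation (tree
ImmediateRationalUniformization); residue extensions f > 1 (CM assume residue field = k) by finite
MacLane key-polynomial chains (defect 0 ⇔ no limit key polynomials, CM §5). [deps:
DefectlessFramesR, PureTranscendentalFrames] [difficulty: XL] -/
@[route_item "route-ResolutionOfSingularities-DefectlessFrames", crux]
def ZariskiCMEngine : Prop :=
  DefectlessFramesR → PureTranscendentalFrames → RankOneZeroDimUniformization

/-- item stmt-ResolutionOfSingularities-0549 · crux · rank 7 · open · by planner
why it might fail: regularity and HasResolution are not stable under inseparable ground-field extension (InseparableBaseChangeResolution, RegularNotGeometricallyRegular); the descent needs spreading out over a f.g. imperfect k plus openness of Reg, possibly open as stated.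
sources: CossartPiltant2019, Temkin2013, Kollar2007, Literature.Barriers.ResolutionOfSingularities.InseparableBaseChange
PerfectToAll: for a prime p, resolution of all reduced separated finite-type schemes over all
PERFECT fields of char p implies ResolutionInChar p (all fields of char p). Expected inputs:
Neron-Popescu (Stacks 07GC), spreading out, openness of regular locus on excellent schemes;
regularity is not stable under inseparable ground field extension, which is the difficulty. -/
@[route_item "route-ResolutionOfSingularities-DefectlessFrames", crux]
def DescentPerfectToAll : Prop :=
  ∀ p : ℕ, p.Prime → (∀ (k : Type) [Field k] [CharP k p] [PerfectField k] (X : AlgebraicGeometry.Scheme.{0}) (f : X ⟶ AlgebraicGeometry.Spec (.of k)), AlgebraicGeometry.IsSeparated f → AlgebraicGeometry.LocallyOfFiniteType f → AlgebraicGeometry.QuasiCompact f → AlgebraicGeometry.IsReduced X → Literature.AlgebraicGeometry.Resolution.Scheme.HasResolution X) → Literature.AlgebraicGeometry.Resolution.ResolutionInChar.{0} p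

/-- item stmt-ResolutionOfSingularities-18877 · support · rank 9 · open · by planner
sources: CutkoskyMourtada2019, Temkin2013
[support] the target is a CONSEQUENCE of the summit (tree lurel_of_resolutionInChar specialised to
rank-one zero-dimensional valuation rings over perfect fields) — the route is two-sided; provable
now. [difficulty: provable-now] -/
@[route_item "route-ResolutionOfSingularities-DefectlessFrames"]
def TargetOfResolution : Prop :=
  _root_.ResolutionOfSingularities → RankOneZeroDimUniformization

/-- item stmt-ResolutionOfSingularities-18878 · support · rank 9 · open · by planner
sources: Kuhlmann2010, KnafKuhlmann2005, Temkin2013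
[support] the defectless half of the lever at ABHYANKAR projections (BC5-type special case, provable
from tree facts): if y : Fin n → O is algebraically independent with K algebraic over k(y) and O ∩
k(y) has transcendence defect 0 over k, then K/k(y) is defectless at every extension of O ∩ k(y)
(IsDefectlessIn): Kuhlmann2010Stability_holds (PROVED in tree) makes (k(y), O ∩ k(y)) a defectless
field. [difficulty: provable-now] -/
@[route_item "route-ResolutionOfSingularities-DefectlessFrames"]
def AbhyankarProjectionsDefectless : Prop :=
  ∀ p : ℕ, p.Prime → ∀ (k K : Type) [Field k] [CharP k p] [PerfectField k] [Field K] [Algebra k K], (⊤ : IntermediateField k K).FG → ∀ O : ValuationSubring K, (∀ c : k, algebraMap k K c ∈ O) → ∀ (n : ℕ) (y : Fin n → O), AlgebraicIndependent k (fun i => (y i : K)) → Algebra.IsAlgebraic (IntermediateField.adjoin k (Set.range fun i => (y i : K))) K → ∀ hk₀ : (∀ c : k, algebraMap k (IntermediateField.adjoin k (Set.range fun i => (y i : K))) c ∈ O.comap (algebraMap (IntermediateField.adjoin k (Set.range fun i => (y i : K))) K)), Literature.AlgebraicGeometry.Resolution.transcendenceDefect k (O.comap (algebraMap (IntermediateField.adjoin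 k (Set.range fun i => (y i : K))) K)) hk₀ = 0 → Literature.AlgebraicGeometry.Resolution.IsDefectlessIn (IntermediateField.adjoin k (Set.range fun i => (y i : K))) (O.comap (algebraMap (IntermediateField.adjoin k (Set.range fun i => (y i : K))) K)) K

-- earlier Assembly (stmt-ResolutionOfSingularities-18879, replaced 2026-08-17T05:08:53Z -> stmt-ResolutionOfSingularities-17923): retired by None — DefectlessFrames → PureTranscendentalFrames → ZariskiCMEngine → ResidueTranscendenceReduction → PatchingRelPerfect → DescentPerfectToAll → _root_.ResolutionOfSingularities
/-- item stmt-ResolutionOfSingularities-17923 · assembly · rank 1 · open · by planner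
sources: Zariski1940, CutkoskyMourtada2019
[assembly] DefectlessFramesR → PureTranscendentalFrames → ZariskiCMEngine →
ResidueTranscendenceReduction → PatchingRelPerfect → DescentPerfectToAll → ResolutionOfSingularities
(rev 3: the repaired lever replaces the refuted DefectlessFrames; this item is literally the
deciding theorem `closes`). -/
@[route_item "route-ResolutionOfSingularities-DefectlessFrames"]
def Assembly : Prop :=
  DefectlessFramesR → PureTranscendentalFrames → ZariskiCMEngine → ResidueTranscendenceReduction → PatchingRelPerfect → DescentPerfectToAll → _root_.ResolutionOfSingularities

-- records of items no longer active in this route (dropped / restated):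
-- earlier DefectlessFrames (stmt-ResolutionOfSingularities-18873, replaced 2026-08-17T03:49:31Z -> stmt-ResolutionOfSingularities-19085): retired by None — ∀ p : ℕ, p.Prime → ∀ (k K : Type) [Field k] [CharP k p] [PerfectField k] [Field K] [Algebra k K], (⊤ : IntermediateField k K).FG → ∀ O : ValuationSubring K, ∀ hk : (∀ c : k, algebraMap k K c ∈ O), Nonempty O.valuation.RankOne → (∀ x ∈ O, ∃ f : Po
-- earlier DefectlessFrames (stmt-ResolutionOfSingularities-19085, replaced 2026-08-17T05:08:53Z -> stmt-ResolutionOfSingularities-17921): refuted by Summit.ResolutionOfSingularities.ResolutionOfSingularities.Theorems.DefectlessFramesDefectlessFrames_refuted @ f246b518946f — ∀ p : ℕ, p.Prime → ∀ (k K : Type) [Field k] [CharP k p] [PerfectField k] [Field K] [Algebra k K], (⊤ : IntermediateField k K).F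

/-! D-0027 §2.1 — DECIDING THEOREM (planner-authored via `route open/edit --closes-file`; by planner-rfix-ResolutionOfSingularities-Defec-bd016126-0 2026-08-17T05:08:53Z):
its hypotheses are this route's items and its conclusion the sub-problem Statement (glue_lint), and it elaborates with this file. -/

@[closes "route-ResolutionOfSingularities-DefectlessFrames"] theorem closes (hDF : DefectlessFramesR) (hPT : PureTranscendentalFrames) (hE : ZariskiCMEngine)
    (hRR : ResidueTranscendenceReduction) (hP : PatchingRelPerfect) (hD : DescentPerfectToAll) :
    _root_.ResolutionOfSingularities := fun p hp =>
  hD p hp (hP p hp (hRR p hp (hE hDF hPT p hp)))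

end Summit.ResolutionOfSingularities.ResolutionOfSingularities.Theses.DefectlessFrames
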